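import Literature.MathematicalPhysics.QuantumFieldTheory.Balaban1983to89.B2Eq265PrintedThresholds

/-!
# `Balaban1983to89.B2Eq265SmallCharge` — [Balaban1982Higgs2] Lemma 2.4 (2.65) p.572, value clause «under the restrictions (2.55)», on
# the (Higgs)₂,₃ carrier of record: F19's bound WITHOUT THE LETTERS `δ_A` AND `|e|` — `δ_A :=` the (2.60) bound itself (p.572 «From the
# property (2.60) we have the inequality |A^{(k)}(x) − A^{(k)}(y)| ≦ O(p(Lᵏε)r(Lᵏε))») and the charge × oscillation product `X·ℓ =
# (Lᵏ·ℓ·|e|·δ_A)·d·S` of F18's grouping majorized through the printed charge-smallness `Lᵏℓ|e|δ_A ≤ c_reg·e_c^β` by `c_reg·e_c^β·d·S`, so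
# that the remainder of (2.65) is written in print's small quantities only: `p(·)` (via `λ_A` and `t′`), `e_c^β` (the charge), `S` (the side
# of `□₂`, print `8r(Lᵏε) + 1`), the (2.75) mass ratio and the `O(s^κ)` tails (`eq265_higgs_region_size_charge`, `eq265_higgs_tower_size_charge`)

statement-level skeleton of published theorems with citation tags; proofs where landed; nothing here is a claim
about the Yang–Mills mass gap

PDF held: `paper:balaban1982-cmp86-higgs23-ii` (journal page = PDF page + 554), p. 572 [PDF 18] (Lemma 2.4; «From the property (2.60) we have
the inequality |A^{(k)}(x) − A^{(k)}(y)| ≦ O(p(Lᵏε)r(Lᵏε)). Let us denote by A₀ a constant configuration equal to A^{(k)}(y) at each point,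
thus A^{(k)} − A₀ = O(p(Lᵏε)r(Lᵏε))»; (2.67); (2.68) «+ O((Lᵏε)^{κ₀}), κ₀ > 0»), p. 571 [PDF 17] ((2.60)), p. 570 [PDF 16] ((2.55)/(2.56)),
p. 573 [PDF 19] ((2.75)–(2.76); «U(A₀(Γ_{x,y}))φ(y) = U(A^{(k)}(Γ^{(k)}_{x,y}))φ(y) + O((Lᵏε)^{κ₀})»), p. 557 [PDF 3] ((2.2), (2.5) «e(ε) = eε^{(4−d)/2}»).

CITATION HEADER (lean-in-tree rule).  T. Bałaban, *(Higgs)₂,₃ quantum fields in a finite volume. II. An upper bound*,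
Commun. Math. Phys. **86** (1982) 555–594, doi:10.1007/bf01214890 [Balaban1982Higgs2].  Cell `lit-balaban` (HOME
`run/shared/lean/pub/lit-balaban/`), Phase-2 proof seat **p23** gen 23 (unit `lit-balaban-p23-g23`; free-target protocol G.5-34(d), TAKING #6
line HOME/STATUS.md 2026-08-23); SKELETON row **B2.Lem2.4** (fold owner r02, second reader r14; head `proved p250408 · …` UNCHANGED —
cells-only member, brick F20).  USED BY NAME, never restated: own F19 `B2Eq265PrintedThresholds.eq265_higgs_region_size_printed` /
`eq265_higgs_tower_size_printed`; b2b's `B1.aSeq`, `B1.aSeq_pos`, `B2.pFn`; the typer's `B2LargeField.lambdaEps`, `lambdaEps_pos`.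

THE ARGUMENT.  In F19 the letter `δ_A` is any number at least the (2.60) bound `δ₆₀ := L^{−k}(C_V·d·ℓ·c₁p(ℓ′) + C_F e^{−δρ₁}c₁p(ℓ′)/(μ₀ℓ′))`
(`ℓ = P.mesh k`, `ℓ′ = s/L`) subject to `Lᵏδ_A|e| ≤ t` and `Lᵏℓ|e|δ_A ≤ c_reg e_c^β`; take `δ_A := δ₆₀` (the bound is monotone in `δ_A`, so
nothing is lost).  The grouped term of F18 is `t′·(Xℓ)·[a_k(E₁ + 4K₀dC₃) + d + E₂a_k² + (Xℓ)·a_k(E₂ + E₃a_k)]` with `Xℓ = |e|δ_A·d·LᵏS·ℓ =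
(Lᵏℓ|e|δ_A)·(dS) ≤ c_reg e_c^β·dS`, and it is monotone in `Xℓ ≥ 0` (all coefficients `≥ 0`): replace `Xℓ` by `c_reg e_c^β·dS`.

WHAT THIS FILE PROVES (kernel-checked, zero `sorry`; theorems only — NO definition, NO `Prop`-valued fact; axioms standard).
 **`eq265_higgs_region_size_charge`** — F19's `eq265_higgs_region_size_printed` word for word except (located edits): the binder
 `∀ {δA : ℝ}, L^{−k}(…) ≤ δA →` DELETED and `δA` ELIMINATED: `(P.L : ℝ) ^ k * δA * |C.e| ≤ t` ↦ `(…) * |C.e| ≤ t`,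
 `(P.L : ℝ) ^ k * P.mesh k * |C.e| * δA ≤ creg * ec ^ β` ↦ `P.mesh k * |C.e| * (…) ≤ creg * ec ^ β` (`(…)` = the (2.60) expression
 `C_V·d·(ℓ·c₁p(ℓ′)) + C_F e^{−δρ₁}·(c₁p(ℓ′)/(μ₀ℓ′))`); in the bound both occurrences of `(|C.e| * (δA * (P.d * (Lᵏ * Sbox)))) * P.mesh k` ↦
 `(creg * ec ^ β * (P.d * Sbox))`.
 **`eq265_higgs_tower_size_charge`** — the same over F19's `eq265_higgs_tower_size_printed` (print's tower regions, cube size `M`, level `j + 1`).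

HONEST SCOPE / DIFFERENCES FROM PRINT (recorded, not hidden; one sentence each).  (a) The bound is now in print's small quantities —
`p(s/L)` (through `λ_A = ℓ·c₁p(s/L)` and `t′ = c₁p(s/L)/λ(s/L)^{1/4}`), the charge smallness `c_reg·e_c^β` (the typed form of print's
`e(Lᵏε) = e(Lᵏε)^{(4−d)/2} → 0`, (2.5)/(1.7)-regularity, as F8–F19 carry it: `c_reg ≥ 0`, `β > 0`, `0 < e_c ≤ e₁` FREE), `S` (print `8r(Lᵏε) + 1`,
free here), the lattice letter `ℓ = P.mesh k`, `a_k`, `K₀`/`M`, `d` — but their PRINTED SIZES under the (2.5) dictionary (`e_c ⇐ e(Lᵏε)`,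
`S ⇐ 8r(s) + 1`, `ℓ` vs `s`: Q-p23g23-1) are NOT evaluated: the «O(p(Lᵏε))» of (2.65) is not asserted.  (b) `δ_A := δ₆₀` is the minimal
admissible value (F19 allows any larger `δ_A` obeying the two smallness conditions; by monotonicity this loses nothing).  (c) The two smallness
conditions are now conditions on the (2.60) expression itself, i.e. on `|e|·p(ℓ′)` — print's «e(ε) sufficiently small» regime; they are
HYPOTHESES, not discharged.  (d) Everything else as in F19's HONEST SCOPE ((a)–(d) there: `ℓ′ = s/L`; `c₁, λ` in front; `μ₀` free; `θ₁, θ₂, κ`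
read; bookkeeping only; nothing minted).  NOT summit progress.
-/

open scoped BigOperators

noncomputable section

namespace Literature.MathematicalPhysics.QuantumFieldTheory.Balaban1983to89.B2Eq265SmallCharge

open HiggsLattice (ChargeData)
open HiggsAveraging (blockIter toFinest)
open HiggsCovariance (avgQkAdj)
open B2Eq255Concrete (bgScalar256 underRegion mem_underRegion Restr255 Restr255Printed)
open B2Eq265PrintedThresholds (eq265_higgs_region_size_printed eq265_higgs_tower_size_printed)
open B2Eq324NestedRegions (prime)
open B2Eq243RegionsTower (towerRegion)
open B2Eq28RegionsConcrete (near)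
open B2Lemma23HiggsLattice (cutMin)
open B1Eq211ZeroFieldTorus (Shape)
open B3MultiscaleFields (toSite ofSite)
open B1Ineq225RegularBox (cellBox)
open B1TorusRegionHSizes (IsBigBlockUnion)
open B1TorusCubeCover (half)
open B1TorusCubeLocality26 (rS)

variable {P : HiggsLattice.Params} {k : ℕ}

/-! ## §1 General regions, cube size `K₀ ∣ M` -/

/-- **LEMMA 2.4 (2.65), VALUE CLAUSE, UNDER THE PRINTED RESTRICTIONS (2.55), `δ_A :=` THE (2.60) BOUND, THE CHARGE × OSCILLATION PRODUCT
MAJORIZED BY `c_reg·e_c^β·d·S`.**  TYPED vs PRINTED: own F19 `B2Eq265PrintedThresholds.eq265_higgs_region_size_printed` word for word except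
the located edits listed in the header (`∀ {δA}, … ≤ δA →` deleted, `δA :=` the (2.60) expression in the two smallness hypotheses, `Xℓ ↦
c_reg·e_c^β·(d·S)` twice in the bound).  [cite: Balaban1982Higgs2, Lemma 2.4 (2.65) p.572]
[cite: Balaban1982Higgs2, Lemma 2.4 proof p.572 «From the property (2.60) we have the inequality |A^{(k)}(x) − A^{(k)}(y)| ≦ O(p(Lᵏε)r(Lᵏε)) … thus A^{(k)} − A₀ = O(p(Lᵏε)r(Lᵏε))», (2.68) p.572 «+ O((Lᵏε)^{κ₀}), κ₀ > 0», p.573 «U(A₀(Γ_{x,y}))φ(y) = U(A^{(k)}(Γ^{(k)}_{x,y}))φ(y) + O((Lᵏε)^{κ₀})»]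
[cite: Balaban1982Higgs2, (2.60) p.571, (2.55)–(2.56) p.570, (2.5) p.557 «e(ε) = eε^{(4−d)/2}», (2.75)–(2.76) p.573] -/
theorem eq265_higgs_region_size_charge (d L : ℕ) (hd : 1 ≤ d) (hL : Odd L ∧ 1 < L) {a : ℝ} (ha : 0 < a) {msq : ℝ} (hmsq : 0 < msq)
    {aV : ℝ} (haV : 0 < aV) {mu0sq : ℝ} (hmu0 : 0 < mu0sq)
    (N : ℕ) (C : ChargeData N) (ε₀ : ℝ) (creg β : ℝ) (hcreg : 0 ≤ creg) (hβ : 0 < β)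
    (Q : B2.Params) (hQ : Q.Printed) {c₁ lam : ℝ} (hc₁ : 0 ≤ c₁) (hlam : 0 < lam) {θ₁ θ₂ : ℝ} (hθ₁ : 0 < θ₁) (hθ₂ : 0 < θ₂)
    (κ : ℝ) :
    ∃ δ CV CF : ℝ, 0 < δ ∧ 0 < CV ∧ 0 < CF ∧
    ∃ K₀min : ℕ, ∀ K₀ : ℕ, K₀min ≤ K₀ → ∃ e₁ t : ℝ, 0 < e₁ ∧ 0 < t ∧
      ∃ C₁ C₂ C₃ D₁ D₂ D₃ D₄ : ℝ, 0 ≤ C₁ ∧ 0 ≤ C₂ ∧ 0 ≤ C₃ ∧ 0 ≤ D₁ ∧ 0 ≤ D₂ ∧ 0 ≤ D₃ ∧ 0 ≤ D₄ ∧ ∃ C' : ℝ, 0 ≤ C' ∧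
      ∃ E₁ E₂ E₃ : ℝ, 0 ≤ E₁ ∧ 0 ≤ E₂ ∧ 0 ≤ E₃ ∧
      ∀ (P : HiggsLattice.Params) (_ : Shape P), P.d = d → P.L = L → K₀ ∣ P.M →
      ∀ {k : ℕ}, 1 ≤ k → k ≤ P.K → (∀ μ, 3 * half P k K₀ ≤ P.sitesPerDir 0 μ) → P.mesh k ≤ ε₀ → P.mesh k ≤ 1 →
      ∀ (Λ₂ Λ₆ sq₂ sq₁ : Finset (HiggsLattice.Site P k)) (S : Fin P.d → Finset ℕ) (q : HiggsLattice.Site P k) (Sbox : ℕ),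
        Λ₆ ⊆ Λ₂ → sq₂ ⊆ Λ₂ → sq₁ ⊆ Λ₆ →
        IsBigBlockUnion k K₀ (underRegion k Λ₂) → underRegion k sq₂ = cellBox k K₀ S →
        (∀ μ : Fin P.d, P.L ^ k * Sbox < P.sitesPerDir 0 μ) →
      -- `□₂` IS the box `q + [0,S)ᵈ` of coarse sites, `□ = B^k(□₂)` smaller than half the torus
        (∀ y : HiggsLattice.Site P k, y ∈ sq₂ ↔ ∀ ν : Fin P.d, (y ν - q ν).val < Sbox) →
        (∀ μ : Fin P.d, 2 * (P.L ^ k * Sbox) ≤ P.sitesPerDir 0 μ) →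
      -- `□₁` is the box of coarse sites of radius `R₁` (corner `q₁`); `m ≥ R₁` a coarse margin with `Lᵏm ≥` the depth radius
      ∀ (q₁ : HiggsLattice.Site P k) (R₁ m : ℕ), R₁ ≤ m → 2 * rS P k K₀ + 2 * half P k K₀ * (P.d + 1) + 1 ≤ P.L ^ k * m →
        (∀ y : HiggsLattice.Site P k, y ∈ sq₁ ↔ ∀ ν : Fin P.d, (y ν - q₁ ν).val < 2 * R₁ + 1) →
      -- the region `Λ₋₁` of (2.55); the cutoff `ζ^{(k)}` of (2.44); the cube of radius `R_n ≥ ρ + 1` about every `y ∈ Λ₂` inside `Λ₋₁` ((2.8))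
      ∀ (Λm1 : Finset (HiggsLattice.Site P k))
        (ζ : HiggsLattice.Site P 0 → HiggsLattice.Site P k → ℝ) (ρ ρ₁ : ℝ), 0 ≤ ρ₁ →
        (∀ x y', |ζ x y'| ≤ 1) →
        (∀ x y', ζ x y' ≠ 0 → (HiggsLattice.Site.tdist (blockIter k x) y' : ℝ) ≤ ρ) →
        (∀ x y', (HiggsLattice.Site.tdist (blockIter k x) y' : ℝ) ≤ ρ₁ → ζ x y' = 1) →
        (∀ (x : HiggsLattice.Site P 0) (ν : Fin P.d) (y' : HiggsLattice.Site P k), |ζ (x.shift ν) y' - ζ x y'| ≤ ((P.L : ℝ) ^ k)⁻¹) →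
      ∀ (Rn : ℕ), ρ + 1 ≤ (Rn : ℝ) → (∀ μ : Fin P.d, 2 * (2 * Rn + 1) ≤ P.sitesPerDir k μ) →
        (∀ y ∈ Λ₂, ∀ y' : HiggsLattice.Site P k, HiggsLattice.Site.tdist y y' ≤ Rn → y' ∈ Λm1) →
      -- a charge datum on `ℝ^d`, the step's vector field `A′`, and print's `μ₀` of the (2.55)₂ threshold
      ∀ (C₀ : ChargeData P.d) (A' : HiggsLattice.VecField P k) {μ₀ : ℝ}, 0 < μ₀ →
      -- THE PHYSICAL SCALE `s ⇐ Lᵏε` AS A FREE LETTER (F18a), the (2.55) letter `L^{k−1}ε ⇐ s/L`: radii readings `m ≥ θ₁r(s)`, `R₁ + 1 ≥ θ₂r(s)`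
      ∀ {s : ℝ}, 0 < s → s ≤ 1 →
        θ₁ * B2.rFn Q.R Q.r s ≤ (m : ℝ) → θ₂ * B2.rFn Q.R Q.r s ≤ (R₁ : ℝ) + 1 →
      -- `δ_A :=` THE (2.60) BOUND ITSELF (read off the printed (2.55)₁,₂ thresholds at `ℓ′ = s/L`), small in the two printed scalings: `Lᵏδ_A|e| ≤ t`, `Lᵏℓ|e|δ_A ≤ c_reg·e_c^β`
        (CV * P.d * (P.mesh k * (c₁ * B2.pFn Q.b₀ Q.p (s / (L : ℝ)))) + CF * Real.exp (-(δ * ρ₁)) * (c₁ * (1 / (μ₀ * (s / (L : ℝ)))) * B2.pFn Q.b₀ Q.p (s / (L : ℝ)))) * |C.e| ≤ t →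
        ∀ {ec : ℝ}, 0 < ec → ec ≤ e₁ → P.mesh k * |C.e| * (CV * P.d * (P.mesh k * (c₁ * B2.pFn Q.b₀ Q.p (s / (L : ℝ)))) + CF * Real.exp (-(δ * ρ₁)) * (c₁ * (1 / (μ₀ * (s / (L : ℝ)))) * B2.pFn Q.b₀ Q.p (s / (L : ℝ)))) ≤ creg * ec ^ β →
      -- `x ∈ Bᵏ(ȳ)` with `ȳ` the centre of `□₁` and at least `m` inside `□₂` in every direction
      ∀ (x : HiggsLattice.Site P 0),
        (∀ ν : Fin P.d, m ≤ ((blockIter k x) ν - q ν).val ∧ ((blockIter k x) ν - q ν).val + m < Sbox) →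
        (∀ ν : Fin P.d, ((blockIter k x) ν - q₁ ν).val = R₁) →
      -- THE PRINTED RESTRICTIONS (2.55) on `Λ₋₁` for `A′, φ` and the background `A^{(k)}`: thresholds `c₁p(ℓ′)`, `c₁p(ℓ′)/(μ₀ℓ′)`, `c₁p(ℓ′)`, `c₁p(ℓ′)/λ(ℓ′)^{1/4}` at `ℓ′ = s/L`
      ∀ (φ : HiggsLattice.ScalarField P k N),
        Restr255Printed C c₁ Q.b₀ Q.p μ₀ lam (s / (L : ℝ)) k Λm1 A' φ (ofSite (cutMin C₀ mu0sq aV k ζ (toSite A'))) →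
        ‖bgScalar256 C msq a k Λ₂ Λ₆ (ofSite (cutMin C₀ mu0sq aV k ζ (toSite A'))) φ x
            - avgQkAdj C (ofSite (cutMin C₀ mu0sq aV k ζ (toSite A'))) k φ x‖
          ≤ C' * B1.aSeq a P.L k * s ^ κ
            + 4 * K₀ * P.d * C₃ * B1.aSeq a P.L k * (P.mesh k * (c₁ * B2.pFn Q.b₀ Q.p (s / (L : ℝ))))
            + (c₁ * (1 / (B2LargeField.lambdaEps lam (s / (L : ℝ)) P.d) ^ (1 / 4 : ℝ)) * B2.pFn Q.b₀ Q.p (s / (L : ℝ))) * (creg * ec ^ β * (P.d * Sbox)) *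
                (B1.aSeq a P.L k * (E₁ + 4 * K₀ * P.d * C₃) + P.d + E₂ * B1.aSeq a P.L k ^ 2
                  + (creg * ec ^ β * (P.d * Sbox)) * B1.aSeq a P.L k * (E₂ + E₃ * B1.aSeq a P.L k))
            + msq * P.mesh k ^ 2 / (B1.aSeq a P.L k + msq * P.mesh k ^ 2) * (c₁ * (1 / (B2LargeField.lambdaEps lam (s / (L : ℝ)) P.d) ^ (1 / 4 : ℝ)) * B2.pFn Q.b₀ Q.p (s / (L : ℝ))) := by
  have hb0 : 0 < Q.b₀ := hQ.2.2.2.2.2.2.1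
  obtain ⟨δ, CV, CF, hδ, hCV, hCF, K₀min, h⟩ :=
    eq265_higgs_region_size_printed d L hd hL ha hmsq haV hmu0 N C ε₀ creg β hcreg hβ Q hQ hc₁ hlam hθ₁ hθ₂ κ
  refine ⟨δ, CV, CF, hδ, hCV, hCF, K₀min, fun K₀ hK₀ => ?_⟩
  obtain ⟨e₁, t, he₁, ht, C₁, C₂, C₃, D₁, D₂, D₃, D₄, hC₁, hC₂, hC₃, hD₁, hD₂, hD₃, hD₄, C', hC', E₁, E₂, E₃, hE₁, hE₂, hE₃, h⟩ :=
    h K₀ hK₀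
  refine ⟨e₁, t, he₁, ht, C₁, C₂, C₃, D₁, D₂, D₃, D₄, hC₁, hC₂, hC₃, hD₁, hD₂, hD₃, hD₄, C', hC', E₁, E₂, E₃, hE₁, hE₂, hE₃, ?_⟩
  intro P S hPd hPL hK₀M k hk1 hkK h3 hε h1 Λ₂ Λ₆ sq₂ sq₁ Sfin q Sbox h62 hs2 h16 hΩΛ hbox hSbox hsq₂ h2S q₁ R₁ m hR₁m hRm hsq₁
    Λm1 ζ ρ ρ₁ hρ₁ zeta_abs zeta_supp zeta_one zeta_lip Rn hRn hRn2 hcube C₀ A' μ₀ hμ₀ s hs hs1 hθm hθR ht' ec hec hle hsmall x hmargin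
    hcentre φ h255
  -- `δ_A :=` the (2.60) bound itself; the two printed smallness conditions in F19's shape
  set δA : ℝ := ((P.L : ℝ) ^ k)⁻¹ * (CV * P.d * (P.mesh k * (c₁ * B2.pFn Q.b₀ Q.p (s / (L : ℝ)))) + CF * Real.exp (-(δ * ρ₁)) * (c₁ * (1 / (μ₀ * (s / (L : ℝ)))) * B2.pFn Q.b₀ Q.p (s / (L : ℝ)))) with hδA_def
  have hLr : 1 < (P.L : ℝ) := by rw [hPL]; exact_mod_cast hL.2
  have hLk : (P.L : ℝ) ^ k ≠ 0 := (pow_pos (by linarith) _).ne'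
  have ht'' : (P.L : ℝ) ^ k * δA * |C.e| ≤ t := by
    rw [hδA_def, mul_inv_cancel_left₀ hLk]; exact ht'
  have hsmall'' : (P.L : ℝ) ^ k * P.mesh k * |C.e| * δA ≤ creg * ec ^ β := by
    have hre : (P.L : ℝ) ^ k * P.mesh k * |C.e| * δA = P.mesh k * |C.e| * ((P.L : ℝ) ^ k * δA) := by ring
    rw [hre, hδA_def, mul_inv_cancel_left₀ hLk]; exact hsmall
  have hmain := h P S hPd hPL hK₀M hk1 hkK h3 hε h1 Λ₂ Λ₆ sq₂ sq₁ Sfin q Sbox h62 hs2 h16 hΩΛ hbox hSbox hsq₂ h2S q₁ R₁ m hR₁m hRm hsq₁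
    Λm1 ζ ρ ρ₁ hρ₁ zeta_abs zeta_supp zeta_one zeta_lip Rn hRn hRn2 hcube C₀ A' hμ₀ hs hs1 hθm hθR (le_refl δA) ht'' hec hle hsmall'' x
    hmargin hcentre φ h255
  -- the charge × oscillation product `X·ℓ = (Lᵏℓ|e|δ_A)·(d·S) ≤ c_reg e_c^β·(d·S)` and the monotonicity of the grouped term in it
  have hL0 : (0 : ℝ) < (L : ℝ) := by exact_mod_cast (lt_trans zero_lt_one hL.2)
  have hℓ' : 0 < s / (L : ℝ) := div_pos hs hL0
  have hℓ'1 : s / (L : ℝ) ≤ 1 := (div_le_self hs.le (by exact_mod_cast hL.2.le)).trans hs1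
  have hlog : 0 ≤ 1 + Real.log (s / (L : ℝ))⁻¹ := by
    have := Real.log_nonneg ((one_le_inv₀ hℓ').mpr hℓ'1)
    linarith
  have hpℓ : 0 ≤ B2.pFn Q.b₀ Q.p (s / (L : ℝ)) := mul_nonneg hb0.le (Real.rpow_nonneg hlog _)
  have htPhi : 0 ≤ 1 / (B2LargeField.lambdaEps lam (s / (L : ℝ)) P.d) ^ (1 / 4 : ℝ) :=
    div_nonneg zero_le_one (Real.rpow_nonneg (B2LargeField.lambdaEps_pos hlam hℓ' P.d).le _)
  have ht0 : 0 ≤ (c₁ * (1 / (B2LargeField.lambdaEps lam (s / (L : ℝ)) P.d) ^ (1 / 4 : ℝ)) * B2.pFn Q.b₀ Q.p (s / (L : ℝ))) := mul_nonneg (mul_nonneg hc₁ htPhi) hpℓ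
  have hA : 0 ≤ B1.aSeq a P.L k := (B1.aSeq_pos ha hLr hk1).le
  have hδA : 0 ≤ δA := by
    rw [hδA_def]
    have h1' : 0 ≤ CV * P.d * (P.mesh k * (c₁ * B2.pFn Q.b₀ Q.p (s / (L : ℝ)))) :=
      mul_nonneg (mul_nonneg hCV.le (Nat.cast_nonneg _)) (mul_nonneg (P.mesh_pos _).le (mul_nonneg hc₁ hpℓ))
    have h2' : 0 ≤ CF * Real.exp (-(δ * ρ₁)) * (c₁ * (1 / (μ₀ * (s / (L : ℝ)))) * B2.pFn Q.b₀ Q.p (s / (L : ℝ))) :=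
      mul_nonneg (mul_nonneg hCF.le (Real.exp_nonneg _)) (mul_nonneg (mul_nonneg hc₁ (by positivity)) hpℓ)
    exact mul_nonneg (inv_nonneg.mpr (pow_nonneg (by linarith) _)) (add_nonneg h1' h2')
  have hmesh : 0 < P.mesh k := P.mesh_pos _
  have hX0 : 0 ≤ |C.e| * (δA * (P.d * ((P.L : ℝ) ^ k * Sbox))) * P.mesh k :=
    mul_nonneg (mul_nonneg (abs_nonneg _) (mul_nonneg hδA (by positivity))) hmesh.le
  have hXY : |C.e| * (δA * (P.d * ((P.L : ℝ) ^ k * Sbox))) * P.mesh k ≤ creg * ec ^ β * (P.d * Sbox) := by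
    calc |C.e| * (δA * (P.d * ((P.L : ℝ) ^ k * Sbox))) * P.mesh k
        = ((P.L : ℝ) ^ k * P.mesh k * |C.e| * δA) * (P.d * Sbox) := by ring
      _ ≤ (creg * ec ^ β) * (P.d * Sbox) := mul_le_mul_of_nonneg_right hsmall'' (by positivity)
  have hK : (0 : ℝ) ≤ K₀ := Nat.cast_nonneg _
  have hB : 0 ≤ E₂ + E₃ * B1.aSeq a P.L k := by positivity
  have hAgrp : 0 ≤ B1.aSeq a P.L k * (E₁ + 4 * K₀ * P.d * C₃) + P.d + E₂ * B1.aSeq a P.L k ^ 2 := by positivity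
  have hinner : B1.aSeq a P.L k * (E₁ + 4 * K₀ * P.d * C₃) + P.d + E₂ * B1.aSeq a P.L k ^ 2
        + |C.e| * (δA * (P.d * ((P.L : ℝ) ^ k * Sbox))) * P.mesh k * B1.aSeq a P.L k * (E₂ + E₃ * B1.aSeq a P.L k)
      ≤ B1.aSeq a P.L k * (E₁ + 4 * K₀ * P.d * C₃) + P.d + E₂ * B1.aSeq a P.L k ^ 2
        + creg * ec ^ β * (P.d * Sbox) * B1.aSeq a P.L k * (E₂ + E₃ * B1.aSeq a P.L k) :=
    add_le_add le_rfl (mul_le_mul_of_nonneg_right (mul_le_mul_of_nonneg_right hXY hA) hB)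
  have hkey : (c₁ * (1 / (B2LargeField.lambdaEps lam (s / (L : ℝ)) P.d) ^ (1 / 4 : ℝ)) * B2.pFn Q.b₀ Q.p (s / (L : ℝ))) * (|C.e| * (δA * (P.d * ((P.L : ℝ) ^ k * Sbox)))) * P.mesh k *
        (B1.aSeq a P.L k * (E₁ + 4 * K₀ * P.d * C₃) + P.d + E₂ * B1.aSeq a P.L k ^ 2
          + |C.e| * (δA * (P.d * ((P.L : ℝ) ^ k * Sbox))) * P.mesh k * B1.aSeq a P.L k * (E₂ + E₃ * B1.aSeq a P.L k))
      ≤ (c₁ * (1 / (B2LargeField.lambdaEps lam (s / (L : ℝ)) P.d) ^ (1 / 4 : ℝ)) * B2.pFn Q.b₀ Q.p (s / (L : ℝ))) * (creg * ec ^ β * (P.d * Sbox)) *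
        (B1.aSeq a P.L k * (E₁ + 4 * K₀ * P.d * C₃) + P.d + E₂ * B1.aSeq a P.L k ^ 2
          + creg * ec ^ β * (P.d * Sbox) * B1.aSeq a P.L k * (E₂ + E₃ * B1.aSeq a P.L k)) := by
    have h1 : (c₁ * (1 / (B2LargeField.lambdaEps lam (s / (L : ℝ)) P.d) ^ (1 / 4 : ℝ)) * B2.pFn Q.b₀ Q.p (s / (L : ℝ))) * (|C.e| * (δA * (P.d * ((P.L : ℝ) ^ k * Sbox)))) * P.mesh k
        ≤ (c₁ * (1 / (B2LargeField.lambdaEps lam (s / (L : ℝ)) P.d) ^ (1 / 4 : ℝ)) * B2.pFn Q.b₀ Q.p (s / (L : ℝ))) * (creg * ec ^ β * (P.d * Sbox)) := by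
      have h1x := mul_le_mul_of_nonneg_left hXY ht0
      simpa only [mul_assoc] using h1x
    have h1' : 0 ≤ (c₁ * (1 / (B2LargeField.lambdaEps lam (s / (L : ℝ)) P.d) ^ (1 / 4 : ℝ)) * B2.pFn Q.b₀ Q.p (s / (L : ℝ))) * (|C.e| * (δA * (P.d * ((P.L : ℝ) ^ k * Sbox)))) * P.mesh k := by
      have h1x := mul_nonneg ht0 hX0
      simpa only [mul_assoc] using h1x
    exact mul_le_mul h1 hinner (add_nonneg hAgrp (mul_nonneg (mul_nonneg hX0 hA) hB)) (h1'.trans h1)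
  exact hmain.trans (add_le_add (add_le_add le_rfl hkey) le_rfl)

/-! ## §2 Print's own tower regions, cube size `M` -/

/-- **THE SAME FOR PRINT'S OWN REGIONS `Λ₂^{(k−1)′} ⊇ Λ₆^{(k−1)′}`, `Λ₋₁^{(k−1)′} ⊇ (near Λ₀^{(k−1)} r)′`.**  TYPED vs PRINTED: own F19
`B2Eq265PrintedThresholds.eq265_higgs_tower_size_printed` with the located edits of `eq265_higgs_region_size_charge` (level `j + 1`, cube size
`M`); `rad`, `bad` data; nothing minted. [cite: Balaban1982Higgs2, Lemma 2.4 (2.65) p.572, (2.60) p.571, (2.55)–(2.56) p.570, (2.7)–(2.8) p.558, (2.43) p.566]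
[cite: Balaban1982Higgs1, Prop. 2.1 p.610 «let Ω^{(k)} ⊂ T^{(k)}_1 be a sum of big blocks with M sufficiently large»] -/
theorem eq265_higgs_tower_size_charge (d L : ℕ) (hd : 1 ≤ d) (hL : Odd L ∧ 1 < L) {a : ℝ} (ha : 0 < a) {msq : ℝ} (hmsq : 0 < msq)
    {aV : ℝ} (haV : 0 < aV) {mu0sq : ℝ} (hmu0 : 0 < mu0sq)
    (N : ℕ) (C : ChargeData N) (ε₀ : ℝ) (creg β : ℝ) (hcreg : 0 ≤ creg) (hβ : 0 < β)
    (Q : B2.Params) (hQ : Q.Printed) {c₁ lam : ℝ} (hc₁ : 0 ≤ c₁) (hlam : 0 < lam) {θ₁ θ₂ : ℝ} (hθ₁ : 0 < θ₁) (hθ₂ : 0 < θ₂)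
    (κ : ℝ) :
    ∃ δ CV CF : ℝ, 0 < δ ∧ 0 < CV ∧ 0 < CF ∧
    ∃ Mmin : ℕ, ∀ M : ℕ, Mmin ≤ M → ∃ e₁ t : ℝ, 0 < e₁ ∧ 0 < t ∧
      ∃ C₁ C₂ C₃ D₁ D₂ D₃ D₄ : ℝ, 0 ≤ C₁ ∧ 0 ≤ C₂ ∧ 0 ≤ C₃ ∧ 0 ≤ D₁ ∧ 0 ≤ D₂ ∧ 0 ≤ D₃ ∧ 0 ≤ D₄ ∧ ∃ C' : ℝ, 0 ≤ C' ∧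
      ∃ E₁ E₂ E₃ : ℝ, 0 ≤ E₁ ∧ 0 ≤ E₂ ∧ 0 ≤ E₃ ∧
      ∀ (P : HiggsLattice.Params) (_ : Shape P), P.d = d → P.L = L → P.M = M →
      ∀ {j : ℕ}, j + 1 ≤ P.K → (∀ μ, 3 * half P (j + 1) M ≤ P.sitesPerDir 0 μ) → P.mesh (j + 1) ≤ ε₀ → P.mesh (j + 1) ≤ 1 →
      -- PRINT'S OWN REGIONS: the (2.7)–(2.8)/(2.43) tower of step `j`, primed to `T^{(k)}`, `k = j + 1`; `Λ₂′ ⊇ □₂`, `Λ₆′ ⊇ □₁`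
      ∀ (bad : (l : ℕ) → Set (HiggsLattice.Site P l)) (rad : ℕ → ℝ), 0 < rad j →
      ∀ (sq₂ sq₁ : Finset (HiggsLattice.Site P (j + 1))) (S : Fin P.d → Finset ℕ) (q : HiggsLattice.Site P (j + 1)) (Sbox : ℕ),
        sq₂ ⊆ prime (towerRegion bad rad j 2) → sq₁ ⊆ prime (towerRegion bad rad j 6) →
        underRegion (j + 1) sq₂ = cellBox (j + 1) M S →
        (∀ μ : Fin P.d, P.L ^ (j + 1) * Sbox < P.sitesPerDir 0 μ) →
      -- `□₂` IS the box `q + [0,S)ᵈ` of coarse sites, `□ = B^k(□₂)` smaller than half the torus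
        (∀ y : HiggsLattice.Site P (j + 1), y ∈ sq₂ ↔ ∀ ν : Fin P.d, (y ν - q ν).val < Sbox) →
        (∀ μ : Fin P.d, 2 * (P.L ^ (j + 1) * Sbox) ≤ P.sitesPerDir 0 μ) →
      -- `□₁` is the box of coarse sites of radius `R₁` (corner `q₁`); `m ≥ R₁` a coarse margin with `Lᵏm ≥` the depth radius
      ∀ (q₁ : HiggsLattice.Site P (j + 1)) (R₁ m : ℕ), R₁ ≤ m → 2 * rS P (j + 1) M + 2 * half P (j + 1) M * (P.d + 1) + 1 ≤ P.L ^ (j + 1) * m →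
        (∀ y : HiggsLattice.Site P (j + 1), y ∈ sq₁ ↔ ∀ ν : Fin P.d, (y ν - q₁ ν).val < 2 * R₁ + 1) →
      -- the cutoff `ζ^{(k)}` of (2.44)
      ∀ (ζ : HiggsLattice.Site P 0 → HiggsLattice.Site P (j + 1) → ℝ) (ρ ρ₁ : ℝ), 0 ≤ ρ₁ →
        (∀ x y', |ζ x y'| ≤ 1) →
        (∀ x y', ζ x y' ≠ 0 → (HiggsLattice.Site.tdist (blockIter (j + 1) x) y' : ℝ) ≤ ρ) →
        (∀ x y', (HiggsLattice.Site.tdist (blockIter (j + 1) x) y' : ℝ) ≤ ρ₁ → ζ x y' = 1) →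
        (∀ (x : HiggsLattice.Site P 0) (ν : Fin P.d) (y' : HiggsLattice.Site P (j + 1)), |ζ (x.shift ν) y' - ζ x y'| ≤ ((P.L : ℝ) ^ (j + 1))⁻¹) →
      -- the cube of radius `R_n ≥ ρ + 1` about `y ∈ Λ₂′` lies in `Λ₋₁′ := (near Λ₀^{(j)} r(Lʲε))′` once `L(R_n + 1) − 1 ≤ 3n`, `n < r(Lʲε)` ((2.8) collars)
      ∀ (Rn : ℕ), ρ + 1 ≤ (Rn : ℝ) → (∀ μ : Fin P.d, 2 * (2 * Rn + 1) ≤ P.sitesPerDir (j + 1) μ) →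
      ∀ (n : ℕ), (n : ℝ) < rad j → (P.L : ℝ) * ((Rn : ℝ) + 1) - 1 ≤ 3 * (n : ℝ) →
      -- a charge datum on `ℝ^d`, the step's vector field `A′`, and print's `μ₀` of the (2.55)₂ threshold
      ∀ (C₀ : ChargeData P.d) (A' : HiggsLattice.VecField P (j + 1)) {μ₀ : ℝ}, 0 < μ₀ →
      -- THE PHYSICAL SCALE `s ⇐ Lᵏε` AS A FREE LETTER (F18a), the (2.55) letter `L^{k−1}ε ⇐ s/L`: radii readings `m ≥ θ₁r(s)`, `R₁ + 1 ≥ θ₂r(s)`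
      ∀ {s : ℝ}, 0 < s → s ≤ 1 →
        θ₁ * B2.rFn Q.R Q.r s ≤ (m : ℝ) → θ₂ * B2.rFn Q.R Q.r s ≤ (R₁ : ℝ) + 1 →
      -- `δ_A :=` THE (2.60) BOUND ITSELF (read off the printed (2.55)₁,₂ thresholds at `ℓ′ = s/L`), small in the two printed scalings: `Lᵏδ_A|e| ≤ t`, `Lᵏℓ|e|δ_A ≤ c_reg·e_c^β`
        (CV * P.d * (P.mesh (j + 1) * (c₁ * B2.pFn Q.b₀ Q.p (s / (L : ℝ)))) + CF * Real.exp (-(δ * ρ₁)) * (c₁ * (1 / (μ₀ * (s / (L : ℝ)))) * B2.pFn Q.b₀ Q.p (s / (L : ℝ)))) * |C.e| ≤ t →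
        ∀ {ec : ℝ}, 0 < ec → ec ≤ e₁ → P.mesh (j + 1) * |C.e| * (CV * P.d * (P.mesh (j + 1) * (c₁ * B2.pFn Q.b₀ Q.p (s / (L : ℝ)))) + CF * Real.exp (-(δ * ρ₁)) * (c₁ * (1 / (μ₀ * (s / (L : ℝ)))) * B2.pFn Q.b₀ Q.p (s / (L : ℝ)))) ≤ creg * ec ^ β →
      -- `x ∈ Bᵏ(ȳ)` with `ȳ` the centre of `□₁` and at least `m` inside `□₂` in every direction
      ∀ (x : HiggsLattice.Site P 0),
        (∀ ν : Fin P.d, m ≤ ((blockIter (j + 1) x) ν - q ν).val ∧ ((blockIter (j + 1) x) ν - q ν).val + m < Sbox) →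
        (∀ ν : Fin P.d, ((blockIter (j + 1) x) ν - q₁ ν).val = R₁) →
      -- THE PRINTED RESTRICTIONS (2.55) on `Λ₋₁` for `A′, φ` and the background `A^{(k)}`: thresholds `c₁p(ℓ′)`, `c₁p(ℓ′)/(μ₀ℓ′)`, `c₁p(ℓ′)`, `c₁p(ℓ′)/λ(ℓ′)^{1/4}` at `ℓ′ = s/L`
      ∀ (φ : HiggsLattice.ScalarField P (j + 1) N),
        Restr255Printed C c₁ Q.b₀ Q.p μ₀ lam (s / (L : ℝ)) (j + 1) (prime (near (towerRegion bad rad j 0) (rad j))) A' φ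
          (ofSite (cutMin C₀ mu0sq aV (j + 1) ζ (toSite A'))) →
        ‖bgScalar256 C msq a (j + 1) (prime (towerRegion bad rad j 2)) (prime (towerRegion bad rad j 6))
              (ofSite (cutMin C₀ mu0sq aV (j + 1) ζ (toSite A'))) φ x
            - avgQkAdj C (ofSite (cutMin C₀ mu0sq aV (j + 1) ζ (toSite A'))) (j + 1) φ x‖
          ≤ C' * B1.aSeq a P.L (j + 1) * s ^ κ
            + 4 * M * P.d * C₃ * B1.aSeq a P.L (j + 1) * (P.mesh (j + 1) * (c₁ * B2.pFn Q.b₀ Q.p (s / (L : ℝ))))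
            + (c₁ * (1 / (B2LargeField.lambdaEps lam (s / (L : ℝ)) P.d) ^ (1 / 4 : ℝ)) * B2.pFn Q.b₀ Q.p (s / (L : ℝ))) * (creg * ec ^ β * (P.d * Sbox)) *
                (B1.aSeq a P.L (j + 1) * (E₁ + 4 * M * P.d * C₃) + P.d + E₂ * B1.aSeq a P.L (j + 1) ^ 2
                  + (creg * ec ^ β * (P.d * Sbox)) * B1.aSeq a P.L (j + 1) * (E₂ + E₃ * B1.aSeq a P.L (j + 1)))
            + msq * P.mesh (j + 1) ^ 2 / (B1.aSeq a P.L (j + 1) + msq * P.mesh (j + 1) ^ 2) * (c₁ * (1 / (B2LargeField.lambdaEps lam (s / (L : ℝ)) P.d) ^ (1 / 4 : ℝ)) * B2.pFn Q.b₀ Q.p (s / (L : ℝ))) := by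
  have hb0 : 0 < Q.b₀ := hQ.2.2.2.2.2.2.1
  obtain ⟨δ, CV, CF, hδ, hCV, hCF, K₀min, h⟩ :=
    eq265_higgs_tower_size_printed d L hd hL ha hmsq haV hmu0 N C ε₀ creg β hcreg hβ Q hQ hc₁ hlam hθ₁ hθ₂ κ
  refine ⟨δ, CV, CF, hδ, hCV, hCF, K₀min, fun M hM => ?_⟩
  obtain ⟨e₁, t, he₁, ht, C₁, C₂, C₃, D₁, D₂, D₃, D₄, hC₁, hC₂, hC₃, hD₁, hD₂, hD₃, hD₄, C', hC', E₁, E₂, E₃, hE₁, hE₂, hE₃, h⟩ :=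
    h M hM
  refine ⟨e₁, t, he₁, ht, C₁, C₂, C₃, D₁, D₂, D₃, D₄, hC₁, hC₂, hC₃, hD₁, hD₂, hD₃, hD₄, C', hC', E₁, E₂, E₃, hE₁, hE₂, hE₃, ?_⟩
  intro P S hPd hPL hPM j hjK h3 hε h1 bad rad hrad sq₂ sq₁ Sfin q Sbox hs2 h16 hbox hSbox hsq₂ h2S q₁ R₁ m hR₁m hRm hsq₁
    ζ ρ ρ₁ hρ₁ zeta_abs zeta_supp zeta_one zeta_lip Rn hRn hRn2 n hn hroom C₀ A' μ₀ hμ₀ s hs hs1 hθm hθR ht' ec hec hle hsmall x hmargin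
    hcentre φ h255
  -- `δ_A :=` the (2.60) bound itself; the two printed smallness conditions in F19's shape
  set δA : ℝ := ((P.L : ℝ) ^ (j + 1))⁻¹ * (CV * P.d * (P.mesh (j + 1) * (c₁ * B2.pFn Q.b₀ Q.p (s / (L : ℝ)))) + CF * Real.exp (-(δ * ρ₁)) * (c₁ * (1 / (μ₀ * (s / (L : ℝ)))) * B2.pFn Q.b₀ Q.p (s / (L : ℝ)))) with hδA_def
  have hLr : 1 < (P.L : ℝ) := by rw [hPL]; exact_mod_cast hL.2
  have hLk : (P.L : ℝ) ^ (j + 1) ≠ 0 := (pow_pos (by linarith) _).ne'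
  have ht'' : (P.L : ℝ) ^ (j + 1) * δA * |C.e| ≤ t := by
    rw [hδA_def, mul_inv_cancel_left₀ hLk]; exact ht'
  have hsmall'' : (P.L : ℝ) ^ (j + 1) * P.mesh (j + 1) * |C.e| * δA ≤ creg * ec ^ β := by
    have hre : (P.L : ℝ) ^ (j + 1) * P.mesh (j + 1) * |C.e| * δA = P.mesh (j + 1) * |C.e| * ((P.L : ℝ) ^ (j + 1) * δA) := by ring
    rw [hre, hδA_def, mul_inv_cancel_left₀ hLk]; exact hsmall
  have hmain := h P S hPd hPL hPM hjK h3 hε h1 bad rad hrad sq₂ sq₁ Sfin q Sbox hs2 h16 hbox hSbox hsq₂ h2S q₁ R₁ m hR₁m hRm hsq₁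
    ζ ρ ρ₁ hρ₁ zeta_abs zeta_supp zeta_one zeta_lip Rn hRn hRn2 n hn hroom C₀ A' hμ₀ hs hs1 hθm hθR (le_refl δA) ht'' hec hle hsmall'' x
    hmargin hcentre φ h255
  -- the charge × oscillation product `X·ℓ = (Lᵏℓ|e|δ_A)·(d·S) ≤ c_reg e_c^β·(d·S)` and the monotonicity of the grouped term in it
  have hL0 : (0 : ℝ) < (L : ℝ) := by exact_mod_cast (lt_trans zero_lt_one hL.2)
  have hℓ' : 0 < s / (L : ℝ) := div_pos hs hL0
  have hℓ'1 : s / (L : ℝ) ≤ 1 := (div_le_self hs.le (by exact_mod_cast hL.2.le)).trans hs1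
  have hlog : 0 ≤ 1 + Real.log (s / (L : ℝ))⁻¹ := by
    have := Real.log_nonneg ((one_le_inv₀ hℓ').mpr hℓ'1)
    linarith
  have hpℓ : 0 ≤ B2.pFn Q.b₀ Q.p (s / (L : ℝ)) := mul_nonneg hb0.le (Real.rpow_nonneg hlog _)
  have htPhi : 0 ≤ 1 / (B2LargeField.lambdaEps lam (s / (L : ℝ)) P.d) ^ (1 / 4 : ℝ) :=
    div_nonneg zero_le_one (Real.rpow_nonneg (B2LargeField.lambdaEps_pos hlam hℓ' P.d).le _)
  have ht0 : 0 ≤ (c₁ * (1 / (B2LargeField.lambdaEps lam (s / (L : ℝ)) P.d) ^ (1 / 4 : ℝ)) * B2.pFn Q.b₀ Q.p (s / (L : ℝ))) := mul_nonneg (mul_nonneg hc₁ htPhi) hpℓ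
  have hA : 0 ≤ B1.aSeq a P.L (j + 1) := (B1.aSeq_pos ha hLr (Nat.succ_le_succ (Nat.zero_le j))).le
  have hδA : 0 ≤ δA := by
    rw [hδA_def]
    have h1' : 0 ≤ CV * P.d * (P.mesh (j + 1) * (c₁ * B2.pFn Q.b₀ Q.p (s / (L : ℝ)))) :=
      mul_nonneg (mul_nonneg hCV.le (Nat.cast_nonneg _)) (mul_nonneg (P.mesh_pos _).le (mul_nonneg hc₁ hpℓ))
    have h2' : 0 ≤ CF * Real.exp (-(δ * ρ₁)) * (c₁ * (1 / (μ₀ * (s / (L : ℝ)))) * B2.pFn Q.b₀ Q.p (s / (L : ℝ))) :=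
      mul_nonneg (mul_nonneg hCF.le (Real.exp_nonneg _)) (mul_nonneg (mul_nonneg hc₁ (by positivity)) hpℓ)
    exact mul_nonneg (inv_nonneg.mpr (pow_nonneg (by linarith) _)) (add_nonneg h1' h2')
  have hmesh : 0 < P.mesh (j + 1) := P.mesh_pos _
  have hX0 : 0 ≤ |C.e| * (δA * (P.d * ((P.L : ℝ) ^ (j + 1) * Sbox))) * P.mesh (j + 1) :=
    mul_nonneg (mul_nonneg (abs_nonneg _) (mul_nonneg hδA (by positivity))) hmesh.le
  have hXY : |C.e| * (δA * (P.d * ((P.L : ℝ) ^ (j + 1) * Sbox))) * P.mesh (j + 1) ≤ creg * ec ^ β * (P.d * Sbox) := by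
    calc |C.e| * (δA * (P.d * ((P.L : ℝ) ^ (j + 1) * Sbox))) * P.mesh (j + 1)
        = ((P.L : ℝ) ^ (j + 1) * P.mesh (j + 1) * |C.e| * δA) * (P.d * Sbox) := by ring
      _ ≤ (creg * ec ^ β) * (P.d * Sbox) := mul_le_mul_of_nonneg_right hsmall'' (by positivity)
  have hK : (0 : ℝ) ≤ M := Nat.cast_nonneg _
  have hB : 0 ≤ E₂ + E₃ * B1.aSeq a P.L (j + 1) := by positivity
  have hAgrp : 0 ≤ B1.aSeq a P.L (j + 1) * (E₁ + 4 * M * P.d * C₃) + P.d + E₂ * B1.aSeq a P.L (j + 1) ^ 2 := by positivity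
  have hinner : B1.aSeq a P.L (j + 1) * (E₁ + 4 * M * P.d * C₃) + P.d + E₂ * B1.aSeq a P.L (j + 1) ^ 2
        + |C.e| * (δA * (P.d * ((P.L : ℝ) ^ (j + 1) * Sbox))) * P.mesh (j + 1) * B1.aSeq a P.L (j + 1) * (E₂ + E₃ * B1.aSeq a P.L (j + 1))
      ≤ B1.aSeq a P.L (j + 1) * (E₁ + 4 * M * P.d * C₃) + P.d + E₂ * B1.aSeq a P.L (j + 1) ^ 2
        + creg * ec ^ β * (P.d * Sbox) * B1.aSeq a P.L (j + 1) * (E₂ + E₃ * B1.aSeq a P.L (j + 1)) :=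
    add_le_add le_rfl (mul_le_mul_of_nonneg_right (mul_le_mul_of_nonneg_right hXY hA) hB)
  have hkey : (c₁ * (1 / (B2LargeField.lambdaEps lam (s / (L : ℝ)) P.d) ^ (1 / 4 : ℝ)) * B2.pFn Q.b₀ Q.p (s / (L : ℝ))) * (|C.e| * (δA * (P.d * ((P.L : ℝ) ^ (j + 1) * Sbox)))) * P.mesh (j + 1) *
        (B1.aSeq a P.L (j + 1) * (E₁ + 4 * M * P.d * C₃) + P.d + E₂ * B1.aSeq a P.L (j + 1) ^ 2
          + |C.e| * (δA * (P.d * ((P.L : ℝ) ^ (j + 1) * Sbox))) * P.mesh (j + 1) * B1.aSeq a P.L (j + 1) * (E₂ + E₃ * B1.aSeq a P.L (j + 1)))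
      ≤ (c₁ * (1 / (B2LargeField.lambdaEps lam (s / (L : ℝ)) P.d) ^ (1 / 4 : ℝ)) * B2.pFn Q.b₀ Q.p (s / (L : ℝ))) * (creg * ec ^ β * (P.d * Sbox)) *
        (B1.aSeq a P.L (j + 1) * (E₁ + 4 * M * P.d * C₃) + P.d + E₂ * B1.aSeq a P.L (j + 1) ^ 2
          + creg * ec ^ β * (P.d * Sbox) * B1.aSeq a P.L (j + 1) * (E₂ + E₃ * B1.aSeq a P.L (j + 1))) := by
    have h1 : (c₁ * (1 / (B2LargeField.lambdaEps lam (s / (L : ℝ)) P.d) ^ (1 / 4 : ℝ)) * B2.pFn Q.b₀ Q.p (s / (L : ℝ))) * (|C.e| * (δA * (P.d * ((P.L : ℝ) ^ (j + 1) * Sbox)))) * P.mesh (j + 1)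
        ≤ (c₁ * (1 / (B2LargeField.lambdaEps lam (s / (L : ℝ)) P.d) ^ (1 / 4 : ℝ)) * B2.pFn Q.b₀ Q.p (s / (L : ℝ))) * (creg * ec ^ β * (P.d * Sbox)) := by
      have h1x := mul_le_mul_of_nonneg_left hXY ht0
      simpa only [mul_assoc] using h1x
    have h1' : 0 ≤ (c₁ * (1 / (B2LargeField.lambdaEps lam (s / (L : ℝ)) P.d) ^ (1 / 4 : ℝ)) * B2.pFn Q.b₀ Q.p (s / (L : ℝ))) * (|C.e| * (δA * (P.d * ((P.L : ℝ) ^ (j + 1) * Sbox)))) * P.mesh (j + 1) := by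
      have h1x := mul_nonneg ht0 hX0
      simpa only [mul_assoc] using h1x
    exact mul_le_mul h1 hinner (add_nonneg hAgrp (mul_nonneg (mul_nonneg hX0 hA) hB)) (h1'.trans h1)
  exact hmain.trans (add_le_add (add_le_add le_rfl hkey) le_rfl)

end Literature.MathematicalPhysics.QuantumFieldTheory.Balaban1983to89.B2Eq265SmallCharge

end
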